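import Literature.Geometry.Lorentzian.CarterFluxEnvelopes
import Literature.Analysis.ODE.KernelTwoPointBound
import Literature.Geometry.Lorentzian.KerrSurfaceGravity
import HarnessLib

/-!
# The flux-regime Green-kernel bound for Carter's equation with its explicit constant (tortoise variable)
(namespace `Literature.Geometry.Lorentzian.Kerr`.)

Carter's radial equation `u″ + (ω² − V(ρ x)) u = 0` (`V = Kerr.sepPotential M a ω m Λ`, `ρ` a tortoise
radius; Dafermos–Rodnianski–Shlapentokh-Rothman arXiv:1402.7034 §5.2.3) in the FLUX REGIME `ωσ > 0`,
`σ := ω − mω₊` (horizon flux `−σ` and infinity flux `ω` of the same sign: non-superradiant, off the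
threshold). For the horizon- and infinity-normalised pair `u_𝓗, u_𝓘` (`‖u_𝓗‖ → 1`, `‖u_𝓗′‖ → |σ|` at
`−∞`; `‖u_𝓘‖ → 1`, `‖u_𝓘′‖ → |ω|` at `+∞`) and GIVEN the census of the full potential at this frequency
(`{r > r₊ : ω² ≤ V r}` order-connected: no well), this file proves the two-point bound

  `‖u_𝓗(x)‖ · ‖u_𝓘(x′)‖ ≤ K(σ, ω, η, Φ, R, L, E) · ‖u_𝓗 u_𝓘′ − u_𝓘 u_𝓗′‖`,  `x ≤ x′`,

with the EXPLICIT kernel constant `K` of `CarterFluxBookkeeping.lean` (there bounded by a power of the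
master variable `Y ≍ Λ/κ`), `Φ = ω² + 6Λ/M²`, `R = max(7M, √(12Λ)/|ω|, 1/(Mω²))`,
`L = (25/κ)log(2496Λ/(σ²M²))`, `E = exp(2ηL)`, for any auxiliary `0 < η` with `η² ≤ σ²/4`, `η² ≤ 6/M²`:

* `forbidden_interval` — the census, read through the strictly increasing bijection `ρ : ℝ → (r₊, ∞)`,
  and the positivity of the coefficient `φ = ω² − V∘ρ` on the horizon zone (`coeff_mem_Icc_of_horizonZone`,
  `φ ≥ σ²/2`) and on the far region (`half_sq_le_omega_sq_sub_sepPotential`, `φ ≥ ω²/2`) make the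
  forbidden set empty or a single compact interval `[b₁, b₂]` with `ρ b₁ ≤ 7M`, `ρ b₂ < R`
  (`exists_Icc_eq_of_ordConnected_nonpos`, `carter_coeff_monotoneOn_far`);
* `fluxRegime_kernel_le` — the one-sided envelopes of `CarterFluxEnvelopes.lean` (`carter_envelope_H` on
  `(−∞, b₁]`, `carter_envelope_I` on `[b₂, ∞)`, plus `carter_envelope_I_horizonZone` when there is no
  barrier) fed into the generic two-point bounds of `Literature.Analysis.ODE.KernelTwoPointBound`
  (`kernel_le_of_envelopes_barrier`; `kernel_le_of_envelope_right` without barrier), the barrier length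
  being at most `L + (7/5)R` (`IsTortoiseRadius.tameZone_length_le`, `IsTortoiseRadius.sub_le_mul_sub`).

No asymptotic analysis enters. This is the analytic core of the flux-regime part of the Λ-polynomial cone
kernel bound of the near-extremal Kerr programme; what is NOT here: the cone arithmetic turning `K` into
`C(M,δ)Λ^Nκ^{-N}` (`CarterConeArithmetic.lean`, `CarterFluxBookkeeping.lean`) and anything about the
threshold sliver `|σ| ≲ κ` or the superradiant regime.

## References
* M. Dafermos, I. Rodnianski, Y. Shlapentokh-Rothman, arXiv:1402.7034 = Ann. of Math. 183 (2016),
  §§5.2.3, 6.3, 8 (key `DafermosRodnianskiShlapentokhrothman2014`); the assembly is folklore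
  (diagonal/two-point resolvent kernel of a one-barrier Schrödinger operator with flux normalisation).
* R. Teixeira da Costa, Commun. Math. Phys. 378 (2020), Prop. 2.20 (fluxes of the normalised pair).
-/

noncomputable section

open Filter Set Literature.Analysis.ODE
open scoped _root_.Topology _root_.ComplexConjugate

namespace Literature.Geometry.Lorentzian

namespace Kerr

section Structural

variable {M a ω Λ : ℝ} {m : ℤ} {ρ : ℝ → ℝ}

/-- **The forbidden set in the tortoise variable.** For a tortoise radius `ρ` of a sub-extremal Kerr
exterior, an admissible triple with `Λ ≥ 1`, `σ = ω − mω₊ ≠ 0`, `ω ≠ 0`, and the census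
`{r > r₊ : ω² ≤ V r}` order-connected: with `ρ x_a = r₊ + σ²M³/(416Λ)` and
`R = max(7M, √(12Λ)/|ω|, 1/(Mω²))`, either the coefficient `φ = ω² − V∘ρ` is positive everywhere, or
`{s | φ s ≤ 0} = [b₁, b₂]` with `x_a < b₁ ≤ b₂`, `ρ b₁ ≤ 7M`, `ρ b₂ < R`, `φ b₁ = φ b₂ = 0`. [folklore] -/
theorem forbidden_interval (hρ : IsTortoiseRadius M a ρ) (hMa : IsSubextremal M a)
    (hadm : IsAdmissibleTriple a ω m Λ) (hΛ : 1 ≤ Λ)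
    (hσ : ω - m * horizonAngularVelocity M a ≠ 0) (hω : ω ≠ 0)
    (hord : (Ioi (rPlus M a) ∩ {r : ℝ | ω ^ 2 ≤ sepPotential M a ω m Λ r}).OrdConnected)
    {xa : ℝ}
    (hxa : ρ xa = rPlus M a + (ω - m * horizonAngularVelocity M a) ^ 2 * M ^ 3 / (416 * Λ)) :
    (∀ s, 0 < ω ^ 2 - sepPotential M a ω m Λ (ρ s)) ∨
      ∃ b₁ b₂, xa < b₁ ∧ b₁ ≤ b₂ ∧ ρ b₁ ≤ 7 * M ∧
        ρ b₂ < max (7 * M) (max (Real.sqrt (12 * Λ) / |ω|) (1 / (M * ω ^ 2))) ∧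
        {s | ω ^ 2 - sepPotential M a ω m Λ (ρ s) ≤ 0} = Icc b₁ b₂ ∧
        ω ^ 2 - sepPotential M a ω m Λ (ρ b₁) = 0 ∧
        ω ^ 2 - sepPotential M a ω m Λ (ρ b₂) = 0 := by
  have hM : 0 < M := hMa.pos
  set σ := ω - m * horizonAngularVelocity M a with hσdef
  set R := max (7 * M) (max (Real.sqrt (12 * Λ) / |ω|) (1 / (M * ω ^ 2))) with hRdef
  set φ : ℝ → ℝ := fun s ↦ ω ^ 2 - sepPotential M a ω m Λ (ρ s) with hφdef
  have hcont : Continuous φ := continuous_iff_continuousAt.2 fun s ↦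
    (hρ.hasDerivAt_omega_sq_sub_sepPotential hMa ω m Λ s).continuousAt
  have hσ2 : 0 < σ ^ 2 := by positivity
  -- the far point `xR` with `ρ xR = R`
  have hR7 : 7 * M ≤ R := le_max_left _ _
  have hRp : rPlus M a < R :=
    lt_of_lt_of_le (by linarith [rPlus_le_two_mul_self hM.le a]) hR7
  obtain ⟨xR, hxR⟩ := hρ.exists_apply_eq hRp
  -- ends are positive
  have hA : ∀ s, s ≤ xa → 0 < φ s := by
    intro s hs
    have hs' : ρ s - rPlus M a ≤ σ ^ 2 * M ^ 3 / (416 * Λ) := by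
      have := (hρ.strictMono hMa).monotone hs
      rw [hxa] at this; linarith
    have h := (coeff_mem_Icc_of_horizonZone hρ hMa hadm hΛ hs').1
    show 0 < ω ^ 2 - sepPotential M a ω m Λ (ρ s)
    linarith
  have hB : ∀ s, xR ≤ s → 0 < φ s := by
    intro s hs
    have hs' : R ≤ ρ s := by rw [← hxR]; exact (hρ.strictMono hMa).monotone hs
    have h := half_sq_le_omega_sq_sub_sepPotential hMa hω hadm hs'
    have hω2 : 0 < ω ^ 2 := by positivity
    show 0 < ω ^ 2 - sepPotential M a ω m Λ (ρ s)
    linarith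
  -- the census in the tortoise variable
  have hordφ : OrdConnected {s | φ s ≤ 0} := by
    refine ⟨fun s₁ hs₁ s₂ hs₂ s hs ↦ ?_⟩
    have h1 : ρ s₁ ∈ Ioi (rPlus M a) ∩ {r : ℝ | ω ^ 2 ≤ sepPotential M a ω m Λ r} :=
      ⟨hρ.rPlus_lt s₁, show ω ^ 2 ≤ _ from sub_nonpos.1 hs₁⟩
    have h2 : ρ s₂ ∈ Ioi (rPlus M a) ∩ {r : ℝ | ω ^ 2 ≤ sepPotential M a ω m Λ r} :=
      ⟨hρ.rPlus_lt s₂, show ω ^ 2 ≤ _ from sub_nonpos.1 hs₂⟩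
    have h := hord.out h1 h2 ⟨(hρ.strictMono hMa).monotone hs.1, (hρ.strictMono hMa).monotone hs.2⟩
    have h2' : ω ^ 2 ≤ sepPotential M a ω m Λ (ρ s) := h.2
    exact sub_nonpos.2 h2'
  rcases exists_Icc_eq_of_ordConnected_nonpos hcont hA hB hordφ with hpos | ⟨b₁, b₂, hab₁, hb, hb₂R, hF, hφ₁, hφ₂⟩
  · exact Or.inl hpos
  · right
    -- `ρ b₁ ≤ 7M`: otherwise `φ` is non-decreasing on `[x₇, ∞)` and positive at `x₇ < b₁`
    have h7p : rPlus M a < 7 * M := by linarith [rPlus_le_two_mul_self hM.le a]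
    obtain ⟨x₇, hx₇⟩ := hρ.exists_apply_eq h7p
    have hb₁7 : ρ b₁ ≤ 7 * M := by
      by_contra hcon
      push Not at hcon
      have hlt : x₇ < b₁ := by rw [← hρ.lt_iff_lt hMa, hx₇]; exact hcon
      have hmono := carter_coeff_monotoneOn_far hρ hMa hadm (x₀ := x₇) hx₇.ge
      have h1 : φ x₇ ≤ φ b₁ := hmono self_mem_Ici (mem_Ici.2 hlt.le) hlt.le
      have h2 : 0 < φ x₇ := by
        by_contra h
        push Not at h
        have : x₇ ∈ Icc b₁ b₂ := by rw [← hF]; exact h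
        exact absurd this.1 (not_le.2 hlt)
      have h3 : φ b₁ = 0 := hφ₁
      linarith
    refine ⟨b₁, b₂, hab₁, hb, hb₁7, ?_, hF, hφ₁, hφ₂⟩
    rw [← hxR]
    exact (hρ.lt_iff_lt hMa).2 hb₂R

end Structural

section Kernel

variable {M a ω Λ : ℝ} {m : ℤ} {ρ : ℝ → ℝ} {uH uH₁ uI uI₁ : ℝ → ℂ}

set_option maxHeartbeats 400000 in
/-- **The flux-regime kernel bound with its explicit constant** (before bookkeeping). For a tortoise
radius `ρ`, an admissible triple with `Λ ≥ 1`, `ωσ > 0` (`σ = ω − mω₊`), `σ²M² ≤ Λ`, the census, the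
horizon- and infinity-data pair `u_𝓗, u_𝓘` of Carter's equation, and an `η` with `0 < η`, `η² ≤ σ²/4`,
`η² ≤ 6/M²`: for all `x ≤ x′`,
`‖u_𝓗 x‖‖u_𝓘 x′‖ ≤ K(σ, ω, η, Φ, R, L, E)·‖W(x)‖` with `Φ = ω² + 6Λ/M²`,
`R = max(7M, √(12Λ)/|ω|, 1/(Mω²))`, `L = (25/κ)log(2496Λ/(σ²M²))`, `E = exp(2ηL)` and `K` the kernel
constant of `kernelConstant_le_pow`. [folklore] -/
theorem fluxRegime_kernel_le (hρ : IsTortoiseRadius M a ρ) (hMa : IsSubextremal M a)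
    (hadm : IsAdmissibleTriple a ω m Λ) (hΛ : 1 ≤ Λ)
    (hωσ : 0 < ω * (ω - m * horizonAngularVelocity M a))
    (hσΛ : (ω - m * horizonAngularVelocity M a) ^ 2 * M ^ 2 ≤ Λ)
    (hord : (Ioi (rPlus M a) ∩ {r : ℝ | ω ^ 2 ≤ sepPotential M a ω m Λ r}).OrdConnected)
    (hu : ∀ x, HasDerivAt uH (uH₁ x) x ∧
      HasDerivAt uH₁ (-(((ω ^ 2 - sepPotential M a ω m Λ (ρ x) : ℝ) : ℂ) * uH x)) x)
    (hv : ∀ x, HasDerivAt uI (uI₁ x) x ∧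
      HasDerivAt uI₁ (-(((ω ^ 2 - sepPotential M a ω m Λ (ρ x) : ℝ) : ℂ) * uI x)) x)
    (hH0 : Tendsto (fun x ↦ ‖uH x‖) atBot (𝓝 1))
    (hH1 : Tendsto (fun x ↦ ‖uH₁ x‖) atBot (𝓝 |ω - m * horizonAngularVelocity M a|))
    (hHf : ∀ x, (starRingEnd ℂ (uH x) * uH₁ x).im = -(ω - m * horizonAngularVelocity M a))
    (hI0 : Tendsto (fun x ↦ ‖uI x‖) atTop (𝓝 1))
    (hI1 : Tendsto (fun x ↦ ‖uI₁ x‖) atTop (𝓝 |ω|))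
    (hIf : ∀ x, (starRingEnd ℂ (uI x) * uI₁ x).im = ω)
    {η : ℝ} (hη : 0 < η) (hησ : η ^ 2 ≤ (ω - m * horizonAngularVelocity M a) ^ 2 / 4)
    (hηM : η ^ 2 ≤ 6 / M ^ 2)
    {σ Φ R L E : ℝ} (hσdef : σ = ω - m * horizonAngularVelocity M a)
    (hΦdef : Φ = ω ^ 2 + 6 * Λ / M ^ 2)
    (hRdef : R = max (7 * M) (max (Real.sqrt (12 * Λ) / |ω|) (1 / (M * ω ^ 2))))
    (hLdef : L = 25 / surfaceGravity M a * Real.log (2496 * Λ / (σ ^ 2 * M ^ 2)))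
    (hEdef : E = Real.exp (2 * η * L)) {x x' : ℝ} (hxx' : x ≤ x') :
    ‖uH x‖ * ‖uI x'‖ ≤
      (3 * (2 * 3 ^ 9 + (Φ / η ^ 2) ^ 16 * E * (3 ^ 10 * σ ^ 2) / η ^ 2) / |σ| +
      3 * ((2 + 2 * |ω| * R) ^ 2 +
            (Φ / η ^ 2) ^ 16 * E * (η ^ 2 * (2 + 2 * |ω| * R) ^ 2 + 2 * ω ^ 2) / η ^ 2 +
            (3 ^ 9 * ((Φ / η ^ 2) ^ 16 * E * (η ^ 2 * (2 + 2 * |ω| * R) ^ 2 + 2 * ω ^ 2)) / η ^ 2 +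
              2 * 3 ^ 8 * ((Φ / η ^ 2) ^ 16 * E * (η ^ 2 * (2 + 2 * |ω| * R) ^ 2 + 2 * ω ^ 2)) /
                σ ^ 2)) / |ω| +
      3 * (Real.sqrt (2 * 3 ^ 9 + (Φ / η ^ 2) ^ 16 * E * (3 ^ 10 * σ ^ 2) / η ^ 2) *
            Real.sqrt ((2 + 2 * |ω| * R) ^ 2 +
              (Φ / η ^ 2) ^ 16 * E * (η ^ 2 * (2 + 2 * |ω| * R) ^ 2 + 2 * ω ^ 2) / η ^ 2 +
              (3 ^ 9 * ((Φ / η ^ 2) ^ 16 * E * (η ^ 2 * (2 + 2 * |ω| * R) ^ 2 + 2 * ω ^ 2)) / η ^ 2 +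
                2 * 3 ^ 8 * ((Φ / η ^ 2) ^ 16 * E * (η ^ 2 * (2 + 2 * |ω| * R) ^ 2 + 2 * ω ^ 2)) /
                  σ ^ 2))) / (2 * Real.sqrt (ω * σ)) +
      2 * (L + 7 / 5 * R)) * ‖uH x * uI₁ x - uI x * uH₁ x‖ := by
  subst hEdef hLdef hRdef hΦdef hσdef
  have hM : 0 < M := hMa.pos
  have haM : |a| ≤ M := le_of_lt hMa
  have hκ : 0 < surfaceGravity M a := hMa.surfaceGravity_pos
  set σ := ω - (m : ℝ) * horizonAngularVelocity M a with hσ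
  have hσ0 : σ ≠ 0 := fun e ↦ by simp [e] at hωσ
  have hω0 : ω ≠ 0 := fun e ↦ by simp [e] at hωσ
  set κ := surfaceGravity M a with hκdef
  -- scalar facts (small context)
  have hη2 : 0 < η ^ 2 := by positivity
  have hσ2 : 0 < σ ^ 2 := by positivity
  have hω2 : 0 < ω ^ 2 := by positivity
  have hQ : 1 ≤ 2496 * Λ / (σ ^ 2 * M ^ 2) := by
    rw [le_div_iff₀ (by positivity), one_mul]
    calc σ ^ 2 * M ^ 2 ≤ Λ := hσΛ
      _ ≤ 2496 * Λ := by linarith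
  have hL0 : 0 ≤ 25 / κ * Real.log (2496 * Λ / (σ ^ 2 * M ^ 2)) :=
    mul_nonneg (div_nonneg (by norm_num) hκ.le) (Real.log_nonneg hQ)
  have hsq : 0 < Real.sqrt (ω * σ) := Real.sqrt_pos.2 hωσ
  have hfrac : σ ^ 2 * M ^ 3 / (416 * Λ) ≤ M / 416 := by
    rw [div_le_div_iff₀ (by positivity) (by norm_num)]
    calc σ ^ 2 * M ^ 3 * 416 = 416 * M * (σ ^ 2 * M ^ 2) := by ring
      _ ≤ 416 * M * Λ := by gcongr
      _ = M * (416 * Λ) := by ring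
  have hr2 : rPlus M a ≤ 2 * M := rPlus_le_two_mul_self hM.le a
  have h7p : rPlus M a < 7 * M := by linarith
  have hxap : rPlus M a < rPlus M a + σ ^ 2 * M ^ 3 / (416 * Λ) :=
    lt_add_of_pos_right _ (by positivity)
  have hxa7 : rPlus M a + σ ^ 2 * M ^ 3 / (416 * Λ) < 7 * M := by linarith
  have hΦη : η ^ 2 ≤ ω ^ 2 + 6 * Λ / M ^ 2 := by
    have h1 : 6 / M ^ 2 ≤ 6 * Λ / M ^ 2 := by
      rw [div_le_div_iff_of_pos_right (by positivity)]; linarith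
    linarith [hω2.le]
  have hΦ0 : 0 ≤ ω ^ 2 + 6 * Λ / M ^ 2 := hη2.le.trans hΦη
  have hΦall : ∀ s, ω ^ 2 - sepPotential M a ω m Λ (ρ s) ≤ ω ^ 2 + 6 * Λ / M ^ 2 := fun s ↦
    coeff_le_of_admissible hM haM hadm hΛ (hρ.rPlus_lt s).le
  have hR7 : 7 * M ≤ max (7 * M) (max (Real.sqrt (12 * Λ) / |ω|) (1 / (M * ω ^ 2))) := le_max_left _ _
  -- the points `xa` (edge of the horizon zone) and `x₇` (`r = 7M`)
  obtain ⟨xa, hxa⟩ := hρ.exists_apply_eq hxap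
  obtain ⟨x₇, hx₇⟩ := hρ.exists_apply_eq h7p
  have hxax₇ : xa < x₇ := by rw [← hρ.lt_iff_lt hMa, hxa, hx₇]; exact hxa7
  -- abbreviations
  set Φ := ω ^ 2 + 6 * Λ / M ^ 2 with hΦ
  set R := max (7 * M) (max (Real.sqrt (12 * Λ) / |ω|) (1 / (M * ω ^ 2))) with hR
  have hR0 : 0 ≤ R := le_trans (by positivity) hR7
  set L := 25 / κ * Real.log (2496 * Λ / (σ ^ 2 * M ^ 2)) with hL
  set E := Real.exp (2 * η * L) with hE
  set T := (Φ / η ^ 2) ^ 16 * E with hT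
  have hT0 : 0 ≤ T := by positivity
  set Pf := 2 + 2 * |ω| * R with hPf
  have hPf0 : 0 ≤ Pf := by positivity
  set Ba := T * (η ^ 2 * Pf ^ 2 + 2 * ω ^ 2) with hBa
  have hBa0 : 0 ≤ Ba := by positivity
  set PH := 2 * 3 ^ 9 + T * (3 ^ 10 * σ ^ 2) / η ^ 2 with hPH
  have hPH0 : 0 ≤ PH := by positivity
  set PI := Pf ^ 2 + Ba / η ^ 2 + (3 ^ 9 * Ba / η ^ 2 + 2 * 3 ^ 8 * Ba / σ ^ 2) with hPI
  have hPI0 : 0 ≤ PI := by positivity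
  set W := ‖uH x * uI₁ x - uI x * uH₁ x‖ with hW
  have hW0 : 0 ≤ W := norm_nonneg _
  -- the target, with the constant `K`
  have hKsplit : ∀ {B : ℝ}, B ≤ 2 * (L + 7 / 5 * R) →
      W * (3 * PH / |σ| + 3 * PI / |ω| + 3 * (Real.sqrt PH * Real.sqrt PI) / (2 * Real.sqrt (ω * σ)) + B) ≤
        (3 * PH / |σ| + 3 * PI / |ω| + 3 * (Real.sqrt PH * Real.sqrt PI) / (2 * Real.sqrt (ω * σ)) +
          2 * (L + 7 / 5 * R)) * W := by
    intro B hB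
    rw [mul_comm]
    exact mul_le_mul_of_nonneg_right (by linarith) hW0
  rcases forbidden_interval hρ hMa hadm hΛ hσ0 hω0 hord hxa with hpos | ⟨b₁, b₂, hab₁, hb, hb₁7, hb₂R, hF, hφ₁, hφ₂⟩
  · -- NO BARRIER: global envelope of `u_𝓘`, pairing
    have hPv : ∀ s, ‖uI s‖ ≤ Real.sqrt PI := by
      intro s
      rw [Real.le_sqrt (norm_nonneg _) hPI0]
      rcases le_or_gt xa s with hs | hs
      · have e1 : ‖uI s‖ ^ 2 ≤ Pf ^ 2 + Ba / η ^ 2 :=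
          carter_envelope_I hρ hMa hadm hΛ hσ0 hω0 hv hI0 hI1 hx₇ hxa.ge hη hΦη hΦall
            (fun t _ ↦ (hpos t).le) hs
        have e2 : 0 ≤ 3 ^ 9 * Ba / η ^ 2 + 2 * 3 ^ 8 * Ba / σ ^ 2 := by positivity
        show ‖uI s‖ ^ 2 ≤ Pf ^ 2 + Ba / η ^ 2 + (3 ^ 9 * Ba / η ^ 2 + 2 * 3 ^ 8 * Ba / σ ^ 2)
        linarith
      · have e1 : ‖uI s‖ ^ 2 ≤ 3 ^ 9 * Ba / η ^ 2 + 2 * 3 ^ 8 * Ba / σ ^ 2 :=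
          carter_envelope_I_horizonZone hρ hMa hadm hΛ hσ0 hω0 hv hI0 hI1 hx₇ hxax₇ hxa hη hΦη
            hΦall (fun t _ ↦ (hpos t).le) hs.le
        have e2 : 0 ≤ Pf ^ 2 + Ba / η ^ 2 := by positivity
        show ‖uI s‖ ^ 2 ≤ Pf ^ 2 + Ba / η ^ 2 + (3 ^ 9 * Ba / η ^ 2 + 2 * 3 ^ 8 * Ba / σ ^ 2)
        linarith
    have key := kernel_le_of_envelope_right (u := uH) (u' := uH₁) (v := uI) (v' := uI₁) hHf hIf hωσ
      hPv x x'
    rw [Real.sq_sqrt hPI0] at key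
    have hω' : 0 < |ω| := abs_pos.2 hω0
    have h1 : PI / |ω| ≤ 3 * PH / |σ| + 3 * PI / |ω| +
        3 * (Real.sqrt PH * Real.sqrt PI) / (2 * Real.sqrt (ω * σ)) + 2 * (L + 7 / 5 * R) := by
      have t1 : 0 ≤ 3 * PH / |σ| := by positivity
      have t2 : PI / |ω| ≤ 3 * PI / |ω| := by
        rw [div_le_div_iff_of_pos_right hω']; linarith
      have t3 : 0 ≤ 3 * (Real.sqrt PH * Real.sqrt PI) / (2 * Real.sqrt (ω * σ)) := by positivity
      have t4 : 0 ≤ 2 * (L + 7 / 5 * R) := by positivity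
      linarith
    calc ‖uH x‖ * ‖uI x'‖ ≤ PI / |ω| * W := key
      _ ≤ _ := mul_le_mul_of_nonneg_right h1 hW0
  · -- ONE BARRIER `[b₁, b₂]`
    set φ : ℝ → ℝ := fun s ↦ ω ^ 2 - sepPotential M a ω m Λ (ρ s) with hφ
    have hout : ∀ s, s ∉ Icc b₁ b₂ → 0 < φ s := by
      intro s hs
      by_contra h
      push Not at h
      have : s ∈ {s | φ s ≤ 0} := h
      rw [hF] at this
      exact hs this
    have hposH : ∀ s, s ≤ b₁ → 0 ≤ ω ^ 2 - sepPotential M a ω m Λ (ρ s) := by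
      intro s hs
      rcases hs.eq_or_lt with h | h
      · rw [h]; exact le_of_eq hφ₁.symm
      · exact (hout s fun hm ↦ absurd hm.1 (not_le.2 h)).le
    have hposI : ∀ s, b₂ ≤ s → 0 ≤ ω ^ 2 - sepPotential M a ω m Λ (ρ s) := by
      intro s hs
      rcases hs.eq_or_lt with h | h
      · rw [← h]; exact le_of_eq hφ₂.symm
      · exact (hout s fun hm ↦ absurd hm.2 (not_le.2 h)).le
    have hφneg : ∀ s ∈ Icc b₁ b₂, φ s ≤ 0 := by
      intro s hs
      have : s ∈ {s | φ s ≤ 0} := by rw [hF]; exact hs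
      exact this
    have hZ₁ : rPlus M a + σ ^ 2 * M ^ 3 / (416 * Λ) ≤ ρ b₁ := by
      rw [← hxa]; exact ((hρ.strictMono hMa).monotone hab₁.le)
    have hZ₂ : rPlus M a + σ ^ 2 * M ^ 3 / (416 * Λ) ≤ ρ b₂ :=
      hZ₁.trans ((hρ.strictMono hMa).monotone hb)
    -- envelopes
    have hPu : ∀ s, s ≤ b₁ → ‖uH s‖ ≤ Real.sqrt PH := by
      intro s hs
      rw [Real.le_sqrt (norm_nonneg _) hPH0]
      exact carter_envelope_H hρ hMa hadm hΛ hσ0 hu hH0 hH1 hxa hb₁7 hη hησ hΦη hΦall hposH hs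
    have hPv : ∀ s, b₂ ≤ s → ‖uI s‖ ≤ Real.sqrt PI := by
      intro s hs
      rw [Real.le_sqrt (norm_nonneg _) hPI0]
      have e1 : ‖uI s‖ ^ 2 ≤ Pf ^ 2 + Ba / η ^ 2 :=
        carter_envelope_I hρ hMa hadm hΛ hσ0 hω0 hv hI0 hI1 hx₇ hZ₂ hη hΦη hΦall hposI hs
      have e2 : 0 ≤ 3 ^ 9 * Ba / η ^ 2 + 2 * 3 ^ 8 * Ba / σ ^ 2 := by positivity
      show ‖uI s‖ ^ 2 ≤ Pf ^ 2 + Ba / η ^ 2 + (3 ^ 9 * Ba / η ^ 2 + 2 * 3 ^ 8 * Ba / σ ^ 2)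
      linarith
    -- barrier length
    have hlen : b₂ - b₁ ≤ L + 7 / 5 * R := by
      have hb₁x₇ : b₁ ≤ x₇ := by rw [← hρ.le_iff_le hMa, hx₇]; exact hb₁7
      rcases le_or_gt b₂ x₇ with h | h
      · have h72 : ρ b₂ ≤ 7 * M := by rw [← hx₇]; exact (hρ.strictMono hMa).monotone h
        have h1 : b₂ - b₁ ≤ L := hρ.tameZone_length_le hMa hσ0 hΛ hZ₁ hb h72
        linarith
      · have h1 : x₇ - b₁ ≤ L := hρ.tameZone_length_le hMa hσ0 hΛ hZ₁ hb₁x₇ hx₇.le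
        have h2 : b₂ - x₇ ≤ 7 / 5 * (ρ b₂ - ρ x₇) := hρ.sub_le_mul_sub hMa h.le hx₇.ge
        have h3 : ρ b₂ - ρ x₇ ≤ R := by rw [hx₇]; linarith [hb₂R.le, hM.le]
        have h4 : 7 / 5 * (ρ b₂ - ρ x₇) ≤ 7 / 5 * R := by gcongr
        linarith
    have key := kernel_le_of_envelopes_barrier
      (φ := fun s ↦ ω ^ 2 - sepPotential M a ω m Λ (ρ s)) hu hv hHf hIf hωσ hb hφneg hPu hPv hxx'
    rw [Real.sq_sqrt hPH0, Real.sq_sqrt hPI0] at key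
    exact key.trans (hKsplit (by linarith))

end Kernel

end Kerr

end Literature.Geometry.Lorentzian

end
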